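import Literature.Analysis.InverseSpectral.HelicalFunctionProofsLimit
import HarnessLib

/-!
# Kreĭn's representation theorem: compactness and Kreĭn's formula

Fifth file of the proof of `Literature.Analysis.InverseSpectral.KreinHelicalRepresentation`
(Arov–Dym 2012, Thm 9.1). From the dyadic lattice package (`exists_lattice_package`) we extract
convergent subsequences — of the masses and coefficients (Bolzano–Weierstrass) and, after
normalisation, of the measures (Prokhorov's theorem, Mathlib
`isCompact_closure_of_isTightMeasureSet`) — and pass to the limit in
`g(t) = g(0) + t Aₙ + ∫ F(t, x) dρₙ(x) + o(1)` at dyadic points `t` (`exists_limit_rep`). Turning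
the limit measure `ρ` into `σ = π(1 + x²) ρ` gives Kreĭn's formula (9.4) at dyadic points, and
continuity extends it to all of `S` (`krein_rep_of_lattice_data`).

## References

* D. Z. Arov, H. Dym, *Bitangential direct and inverse problems…*, CUP 2012, Thm 9.1.
* P. Billingsley, *Convergence of probability measures*, 2nd ed. (1999), Thm 5.1 (Prokhorov).
-/

open MeasureTheory Set Complex Filter Finset Literature.Analysis.FunctionSpaces
open scoped ComplexConjugate ENNReal NNReal Topology BigOperators ComplexOrder BoundedContinuousFunction

noncomputable section

namespace Literature.Analysis.InverseSpectral

/-! ### Tightness and weak limits -/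

/-- A sequence of finite measures on `ℝ` which is *eventually* uniformly tight is a tight set (the
finitely many initial measures are tight individually). [folklore] -/
theorem isTightMeasureSet_range_of_eventually' {μ : ℕ → Measure ℝ} [∀ n, IsFiniteMeasure (μ n)]
    (h : ∀ ε : ℝ≥0∞, 0 < ε → ∃ K : Set ℝ, IsCompact K ∧ ∀ᶠ n in atTop, μ n Kᶜ ≤ ε) :
    IsTightMeasureSet (Set.range μ) := by
  rw [isTightMeasureSet_iff_exists_isCompact_measure_compl_le]
  intro ε hε
  obtain ⟨K, hK, hev⟩ := h ε hε
  obtain ⟨M, hM⟩ := eventually_atTop.1 hev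
  have hsingle : ∀ n, ∃ K' : Set ℝ, IsCompact K' ∧ μ n K'ᶜ ≤ ε := fun n => by
    obtain ⟨K', hK', hb⟩ := (isTightMeasureSet_iff_exists_isCompact_measure_compl_le.1
      (isTightMeasureSet_singleton (μ := μ n))) ε hε
    exact ⟨K', hK', hb _ rfl⟩
  choose K' hK' hμK' using hsingle
  refine ⟨K ∪ ⋃ n ∈ Finset.range M, K' n, hK.union ((Finset.range M).isCompact_biUnion
    fun n _ => hK' n), ?_⟩
  rintro _ ⟨n, rfl⟩
  rcases lt_or_ge n M with hn | hn
  · calc μ n (K ∪ ⋃ m ∈ Finset.range M, K' m)ᶜ ≤ μ n (K' n)ᶜ := by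
          refine measure_mono (Set.compl_subset_compl.2 ?_)
          exact Set.subset_union_of_subset_right
            (Set.subset_biUnion_of_mem (u := fun m => K' m) (Finset.mem_range.2 hn)) K
      _ ≤ ε := hμK' n
  · calc μ n (K ∪ ⋃ m ∈ Finset.range M, K' m)ᶜ ≤ μ n Kᶜ :=
          measure_mono (Set.compl_subset_compl.2 Set.subset_union_left)
      _ ≤ ε := hM n hn

/-- Weak convergence of probability measures gives convergence of `∫ F(t, x)` (a bounded
continuous complex integrand: real and imaginary parts separately). [folklore] -/
theorem tendsto_integral_F_of_tendsto {P : ℕ → ProbabilityMeasure ℝ} {P₀ : ProbabilityMeasure ℝ}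
    (hP : Tendsto P atTop (𝓝 P₀)) (t : ℝ) :
    Tendsto (fun n => ∫ x, (kreinHelicalIntegrand (t) (x) * (((1 : ℝ) + (x) ^ 2 : ℝ) : ℂ)) ∂(P n : Measure ℝ)) atTop (𝓝 (∫ x, (kreinHelicalIntegrand (t) (x) * (((1 : ℝ) + (x) ^ 2 : ℝ) : ℂ)) ∂(P₀ : Measure ℝ))) := by
  set B : ℝ := 2 * t ^ 2 + 2 * |t| + 4 with hB
  have hcont := continuous_F t
  -- real and imaginary parts as bounded continuous functions
  set fre : ℝ →ᵇ ℝ := BoundedContinuousFunction.ofNormedAddCommGroup (fun x => ((kreinHelicalIntegrand (t) (x) * (((1 : ℝ) + (x) ^ 2 : ℝ) : ℂ))).re)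
    (Complex.continuous_re.comp hcont) B (fun x => (Complex.abs_re_le_norm _).trans (norm_F_le t x))
    with hfre
  set fim : ℝ →ᵇ ℝ := BoundedContinuousFunction.ofNormedAddCommGroup (fun x => ((kreinHelicalIntegrand (t) (x) * (((1 : ℝ) + (x) ^ 2 : ℝ) : ℂ))).im)
    (Complex.continuous_im.comp hcont) B (fun x => (Complex.abs_im_le_norm _).trans (norm_F_le t x))
    with hfim
  have h := ProbabilityMeasure.tendsto_iff_forall_integral_tendsto.1 hP
  have hre := h fre
  have him := h fim
  simp only [hfre, hfim, BoundedContinuousFunction.coe_ofNormedAddCommGroup] at hre him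
  have hdecomp : ∀ μ : Measure ℝ, IsFiniteMeasure μ → ∫ x, (kreinHelicalIntegrand (t) (x) * (((1 : ℝ) + (x) ^ 2 : ℝ) : ℂ)) ∂μ =
      ((∫ x, ((kreinHelicalIntegrand (t) (x) * (((1 : ℝ) + (x) ^ 2 : ℝ) : ℂ))).re ∂μ : ℝ) : ℂ) + ((∫ x, ((kreinHelicalIntegrand (t) (x) * (((1 : ℝ) + (x) ^ 2 : ℝ) : ℂ))).im ∂μ : ℝ) : ℂ) * I := by
    intro μ hμ
    have hint : Integrable (fun x => (kreinHelicalIntegrand (t) (x) * (((1 : ℝ) + (x) ^ 2 : ℝ) : ℂ))) μ := integrable_F μ t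
    have := integral_re_add_im hint
    simpa using this.symm
  rw [hdecomp _ inferInstance]
  have : ∀ n, ∫ x, (kreinHelicalIntegrand (t) (x) * (((1 : ℝ) + (x) ^ 2 : ℝ) : ℂ)) ∂(P n : Measure ℝ) =
      ((∫ x, ((kreinHelicalIntegrand (t) (x) * (((1 : ℝ) + (x) ^ 2 : ℝ) : ℂ))).re ∂(P n : Measure ℝ) : ℝ) : ℂ) +
        ((∫ x, ((kreinHelicalIntegrand (t) (x) * (((1 : ℝ) + (x) ^ 2 : ℝ) : ℂ))).im ∂(P n : Measure ℝ) : ℝ) : ℂ) * I := fun n => hdecomp _ inferInstance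
  simp_rw [this]
  exact ((Complex.continuous_ofReal.tendsto _).comp hre).add
    (((Complex.continuous_ofReal.tendsto _).comp him).mul tendsto_const_nhds)

/-! ### The limit representation at dyadic points -/

section Limit

variable {a : ℝ} {S : Set ℝ} {g : ℝ → ℂ} {D : ℕ → ℤ → ℂ}

/-- **Compactness step.** From the dyadic lattice package: along a subsequence the masses, the
coefficients and (after normalisation, by Prokhorov's theorem) the measures converge, and the
representation passes to the limit at every dyadic point of `S`:
`g(t) = g(0) + t A + ∫ F(t, x) dρ(x)` with `ρ` finite and `Re A = 0`. [folklore] -/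
theorem exists_limit_rep (ha : 0 < a) (hIcc : Set.Icc (-a) a ⊆ S)
    (hstar : ∀ t ∈ S, ∀ s : ℝ, |s| ≤ |t| → s ∈ S)
    (hg : ContinuousOn g S) (hherm : ∀ t ∈ S, g (-t) = conj (g t))
    (hD : ∀ n, IsPositiveDefinite (D n))
    (hDd : ∀ (n : ℕ) (j : ℤ), (|(j : ℝ)| + 1) * (a / 2 ^ (n + 3)) ∈ S →
      D n j = 2 * g (j * (a / 2 ^ (n + 3))) - g ((j + 1) * (a / 2 ^ (n + 3))) -
        g ((j - 1) * (a / 2 ^ (n + 3)))) :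
    ∃ (A : ℂ) (ρ : Measure ℝ), IsFiniteMeasure ρ ∧ A.re = 0 ∧
      ∀ (m : ℕ) (j : ℤ), (j : ℝ) * (a / 2 ^ m) ∈ S →
        g (j * (a / 2 ^ m)) = g 0 + ((j * (a / 2 ^ m) : ℝ) : ℂ) * A + ∫ x, (kreinHelicalIntegrand (j * (a / 2 ^ m)) (x) * (((1 : ℝ) + (x) ^ 2 : ℝ) : ℂ)) ∂ρ := by
  obtain ⟨ρ, A, hfin, hAre, ⟨C, hC⟩, ⟨CA, hCA⟩, htight, hdy⟩ :=
    exists_lattice_package ha hIcc hstar hg hherm hD hDd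
  -- Step 1: a subsequence along which masses and coefficients converge
  set u : ℕ → ℝ × ℂ := fun n => ((ρ n).real Set.univ, A n) with hu
  have hbdd : ∀ n, u n ∈ Metric.closedBall (0 : ℝ × ℂ) (|C| + |CA|) := by
    intro n
    rw [Metric.mem_closedBall, dist_zero_right, Prod.norm_def, max_le_iff]
    constructor
    · rw [Real.norm_eq_abs, abs_of_nonneg measureReal_nonneg]
      exact (hC n).trans ((le_abs_self C).trans (by linarith [abs_nonneg CA]))
    · exact (hCA n).trans ((le_abs_self CA).trans (by linarith [abs_nonneg C]))
  obtain ⟨p, -, φ, hφ, hφlim⟩ := tendsto_subseq_of_bounded Metric.isBounded_closedBall hbdd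
  have hmass : Tendsto (fun n => (ρ (φ n)).real Set.univ) atTop (𝓝 p.1) :=
    (continuous_fst.tendsto p).comp hφlim
  have hAlim : Tendsto (fun n => A (φ n)) atTop (𝓝 p.2) := (continuous_snd.tendsto p).comp hφlim
  have hAre' : p.2.re = 0 :=
    (isClosed_eq Complex.continuous_re continuous_const).mem_of_tendsto hAlim
      (Eventually.of_forall fun n => hAre (φ n))
  have hm0 : 0 ≤ p.1 :=
    isClosed_Ici.mem_of_tendsto hmass (Eventually.of_forall fun n => measureReal_nonneg)
  -- Step 2: a further subsequence along which `∫ F(t, ·) dρ` converges, for every `t`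
  have hstep2 : ∃ (χ : ℕ → ℕ) (ρ₀ : Measure ℝ), IsFiniteMeasure ρ₀ ∧ Tendsto χ atTop atTop ∧
      Tendsto (fun n => A (χ n)) atTop (𝓝 p.2) ∧
      ∀ t : ℝ, Tendsto (fun n => ∫ x, (kreinHelicalIntegrand (t) (x) * (((1 : ℝ) + (x) ^ 2 : ℝ) : ℂ)) ∂(ρ (χ n))) atTop (𝓝 (∫ x, (kreinHelicalIntegrand (t) (x) * (((1 : ℝ) + (x) ^ 2 : ℝ) : ℂ)) ∂ρ₀)) := by
    by_cases hp : p.1 = 0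
    · -- masses tend to zero: the integrals vanish in the limit
      refine ⟨φ, 0, inferInstance, hφ.tendsto_atTop, hAlim, fun t => ?_⟩
      rw [integral_zero_measure]
      refine squeeze_zero_norm (fun n => norm_integral_F_le (ρ (φ n)) t) ?_
      have := hmass.const_mul (2 * t ^ 2 + 2 * |t| + 4)
      rwa [hp, mul_zero] at this
    · -- masses bounded below: normalise and apply Prokhorov
      have hp0 : 0 < p.1 := lt_of_le_of_ne hm0 (Ne.symm hp)
      obtain ⟨n₀, hn₀⟩ := eventually_atTop.1 (hmass.eventually_const_lt (half_lt_self hp0))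
      set μ : ℕ → FiniteMeasure ℝ := fun k => ⟨ρ (φ (k + n₀)), hfin _⟩ with hμ
      have hμmass : ∀ k, ((μ k).mass : ℝ) = (ρ (φ (k + n₀))).real Set.univ := fun k => by
        simp only [hμ, FiniteMeasure.mass, FiniteMeasure.coeFn_def, measureReal_def]
        rfl
      have hμpos : ∀ k, p.1 / 2 < ((μ k).mass : ℝ) := fun k => by
        rw [hμmass]; exact hn₀ _ (Nat.le_add_left _ _)
      have hμne : ∀ k, μ k ≠ 0 := fun k => by
        rw [← FiniteMeasure.mass_nonzero_iff]
        have := hμpos k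
        intro h0
        rw [h0, NNReal.coe_zero] at this
        linarith
      set P : ℕ → ProbabilityMeasure ℝ := fun k => (μ k).normalize with hPdef
      have hPμ : ∀ k, (ρ (φ (k + n₀)) : Measure ℝ) = ((μ k).mass : ℝ≥0) • (P k : Measure ℝ) := by
        intro k
        rw [hPdef, FiniteMeasure.toMeasure_normalize_eq_of_nonzero _ (hμne k), smul_smul,
          mul_inv_cancel₀ ((FiniteMeasure.mass_nonzero_iff _).2 (hμne k)), one_smul]
        rfl
      -- tightness of the normalised measures
      have htightP : IsTightMeasureSet (Set.range fun k => (P k : Measure ℝ)) := by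
        refine isTightMeasureSet_range_of_eventually' fun ε hε => ?_
        -- choose a real `ε' > 0` below `ε` and control `ρ`-tails by `ε' p.1 / 2`
        rcases ENNReal.lt_iff_exists_real_btwn.1 hε with ⟨ε', hε'0, hε'pos, hε'lt⟩
        have hε'0' : 0 < ε' := ENNReal.ofReal_pos.1 hε'pos
        obtain ⟨R, hR⟩ := htight (ε' * (p.1 / 2)) (by positivity)
        refine ⟨Set.Icc (-R) R, isCompact_Icc, ?_⟩
        have hφ' : Tendsto (fun k => φ (k + n₀)) atTop atTop :=
          hφ.tendsto_atTop.comp (tendsto_add_atTop_nat n₀)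
        filter_upwards [hφ'.eventually hR] with k hk
        have hsub : (Set.Icc (-R) R)ᶜ ⊆ {x : ℝ | R ≤ |x|} := by
          intro x hx
          rw [Set.mem_setOf_eq]
          simp only [Set.mem_compl_iff, Set.mem_Icc, not_and_or, not_le] at hx
          rcases hx with hx | hx
          · have h1 : -x ≤ |x| := neg_le_abs x
            linarith
          · have h1 : x ≤ |x| := le_abs_self x
            linarith
        have h1 : (P k : Measure ℝ) (Set.Icc (-R) R)ᶜ ≤ (P k : Measure ℝ) {x : ℝ | R ≤ |x|} :=
          measure_mono hsub
        refine h1.trans ?_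
        -- `P = mass⁻¹ ρ`
        have h2 : (P k : Measure ℝ) {x : ℝ | R ≤ |x|} =
            ((μ k).mass : ℝ≥0∞)⁻¹ * (ρ (φ (k + n₀))) {x : ℝ | R ≤ |x|} := by
          rw [hPdef, FiniteMeasure.toMeasure_normalize_eq_of_nonzero _ (hμne k), Measure.smul_apply,
            ENNReal.smul_def, ENNReal.coe_inv ((FiniteMeasure.mass_nonzero_iff _).2 (hμne k))]
          rfl
        rw [h2]
        have hmassk : ((μ k).mass : ℝ≥0∞) = ENNReal.ofReal ((ρ (φ (k + n₀))).real Set.univ) := by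
          rw [← hμmass, ENNReal.ofReal_coe_nnreal]
        have hρfin : (ρ (φ (k + n₀))) {x : ℝ | R ≤ |x|} =
            ENNReal.ofReal ((ρ (φ (k + n₀))).real {x : ℝ | R ≤ |x|}) := by
          haveI := hfin (φ (k + n₀))
          rw [measureReal_def, ENNReal.ofReal_toReal (measure_ne_top _ _)]
        rw [hmassk, hρfin, ← ENNReal.ofReal_inv_of_pos (by linarith [hμpos k, hμmass k]),
          ← ENNReal.ofReal_mul (by positivity)]
        refine (ENNReal.ofReal_le_ofReal ?_).trans hε'lt.le
        have hmk : p.1 / 2 < (ρ (φ (k + n₀))).real Set.univ := by rw [← hμmass]; exact hμpos k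
        rw [inv_mul_le_iff₀ (by linarith)]
        calc (ρ (φ (k + n₀))).real {x | R ≤ |x|} ≤ ε' * (p.1 / 2) := hk
          _ ≤ (ρ (φ (k + n₀))).real Set.univ * ε' := by nlinarith
      -- Prokhorov: a weakly convergent subsequence of `P`
      have hcomp : IsCompact (closure (Set.range P)) := by
        refine isCompact_closure_of_isTightMeasureSet ?_
        convert htightP using 1
        ext ν'
        simp
      obtain ⟨P₀, -, ψ, hψ, hPlim⟩ :=
        hcomp.tendsto_subseq (fun k => subset_closure (Set.mem_range_self k))
      refine ⟨fun n => φ (ψ n + n₀), (p.1.toNNReal : ℝ≥0) • (P₀ : Measure ℝ), inferInstance,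
        ?_, ?_, fun t => ?_⟩
      · exact hφ.tendsto_atTop.comp ((tendsto_add_atTop_nat n₀).comp hψ.tendsto_atTop)
      · exact hAlim.comp ((tendsto_add_atTop_nat n₀).comp hψ.tendsto_atTop)
      · -- `∫ F dρ_{φ(ψ n + n₀)} = mass • ∫ F dP_{ψ n} → p.1 • ∫ F dP₀`
        have heq : ∀ n, ∫ x, (kreinHelicalIntegrand (t) (x) * (((1 : ℝ) + (x) ^ 2 : ℝ) : ℂ)) ∂(ρ (φ (ψ n + n₀))) =
            ((μ (ψ n)).mass : ℝ) • ∫ x, (kreinHelicalIntegrand (t) (x) * (((1 : ℝ) + (x) ^ 2 : ℝ) : ℂ)) ∂(P (ψ n) : Measure ℝ) := by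
          intro n
          rw [hPμ (ψ n), integral_smul_nnreal_measure]
          rfl
        simp_rw [heq]
        rw [integral_smul_nnreal_measure]
        have hm' : Tendsto (fun n => ((μ (ψ n)).mass : ℝ)) atTop (𝓝 p.1) := by
          have := hmass.comp ((tendsto_add_atTop_nat n₀).comp hψ.tendsto_atTop)
          refine this.congr fun n => ?_
          simp only [Function.comp_apply, hμmass]
        have hI := tendsto_integral_F_of_tendsto hPlim t
        have := hm'.smul hI
        rw [show (p.1.toNNReal : ℝ≥0) • ∫ x, (kreinHelicalIntegrand (t) (x) * (((1 : ℝ) + (x) ^ 2 : ℝ) : ℂ)) ∂(P₀ : Measure ℝ) =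
          p.1 • ∫ x, (kreinHelicalIntegrand (t) (x) * (((1 : ℝ) + (x) ^ 2 : ℝ) : ℂ)) ∂(P₀ : Measure ℝ) by
            rw [NNReal.smul_def, Real.coe_toNNReal _ hm0]]
        exact this
  obtain ⟨χ, ρ₀, hρ₀, hχ, hAχ, hIχ⟩ := hstep2
  refine ⟨p.2, ρ₀, hρ₀, hAre', fun m j hjS => ?_⟩
  -- Step 3: pass to the limit at the dyadic point
  set t : ℝ := j * (a / 2 ^ m) with ht
  have h1 : Tendsto (fun n => g t - (g 0 + ((t : ℝ) : ℂ) * A (χ n) + ∫ x, (kreinHelicalIntegrand (t) (x) * (((1 : ℝ) + (x) ^ 2 : ℝ) : ℂ)) ∂(ρ (χ n))))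
      atTop (𝓝 0) := (hdy m j hjS).comp hχ
  have h2 : Tendsto (fun n => g 0 + ((t : ℝ) : ℂ) * A (χ n) + ∫ x, (kreinHelicalIntegrand (t) (x) * (((1 : ℝ) + (x) ^ 2 : ℝ) : ℂ)) ∂(ρ (χ n)))
      atTop (𝓝 (g 0 + ((t : ℝ) : ℂ) * p.2 + ∫ x, (kreinHelicalIntegrand (t) (x) * (((1 : ℝ) + (x) ^ 2 : ℝ) : ℂ)) ∂ρ₀)) :=
    (tendsto_const_nhds.add (tendsto_const_nhds.mul hAχ)).add (hIχ t)
  have h3 : Tendsto (fun n => (g t - (g 0 + ((t : ℝ) : ℂ) * A (χ n) + ∫ x, (kreinHelicalIntegrand (t) (x) * (((1 : ℝ) + (x) ^ 2 : ℝ) : ℂ)) ∂(ρ (χ n)))) +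
      (g 0 + ((t : ℝ) : ℂ) * A (χ n) + ∫ x, (kreinHelicalIntegrand (t) (x) * (((1 : ℝ) + (x) ^ 2 : ℝ) : ℂ)) ∂(ρ (χ n)))) atTop
      (𝓝 (0 + (g 0 + ((t : ℝ) : ℂ) * p.2 + ∫ x, (kreinHelicalIntegrand (t) (x) * (((1 : ℝ) + (x) ^ 2 : ℝ) : ℂ)) ∂ρ₀))) := h1.add h2
  simp only [sub_add_cancel, zero_add] at h3
  exact tendsto_nhds_unique tendsto_const_nhds h3

end Limit

/-! ### Kreĭn's formula from the limit representation -/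

section Assembly

variable {a : ℝ} {S : Set ℝ} {g : ℝ → ℂ} {D : ℕ → ℤ → ℂ}

/-- Two functions continuous on `S` which agree on a subset `T` with `S ⊆ closure T` agree on `S`.
[folklore] -/
lemma eqOn_of_eqOn_dense {T : Set ℝ} {f₁ f₂ : ℝ → ℂ} (hTS : T ⊆ S) (hdense : S ⊆ closure T)
    (h₁ : ContinuousOn f₁ S) (h₂ : ContinuousOn f₂ S) (heq : ∀ t ∈ T, f₁ t = f₂ t) :
    ∀ t ∈ S, f₁ t = f₂ t := by
  intro t ht
  haveI : (𝓝[T] t).NeBot := mem_closure_iff_nhdsWithin_neBot.1 (hdense ht)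
  have c₁ : Tendsto f₁ (𝓝[T] t) (𝓝 (f₁ t)) := (h₁ t ht).mono_left (nhdsWithin_mono _ hTS)
  have c₂ : Tendsto f₂ (𝓝[T] t) (𝓝 (f₂ t)) := (h₂ t ht).mono_left (nhdsWithin_mono _ hTS)
  have c₂' : Tendsto f₁ (𝓝[T] t) (𝓝 (f₂ t)) :=
    c₂.congr' (eventually_nhdsWithin_of_forall fun s hs => (heq s hs).symm)
  exact tendsto_nhds_unique c₁ c₂'

/-- **Kreĭn's formula from lattice data.** Under the hypotheses of `exists_limit_rep` and the
density of the dyadic points of `S` in `S`, `g` admits Kreĭn's representation (9.4) on `S` with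
data (9.5): `σ = π(1 + x²) ρ`, `α = Im A`, `β = -g(0)`. [cite: ArovDym2012, Thm 9.1] -/
theorem krein_rep_of_lattice_data (ha : 0 < a) (hIcc : Set.Icc (-a) a ⊆ S)
    (hstar : ∀ t ∈ S, ∀ s : ℝ, |s| ≤ |t| → s ∈ S)
    (hdense : S ⊆ closure {t ∈ S | ∃ m : ℕ, ∃ j : ℤ, t = j * (a / 2 ^ m)})
    (hg : ContinuousOn g S) (hherm : ∀ t ∈ S, g (-t) = conj (g t))
    (hD : ∀ n, IsPositiveDefinite (D n))
    (hDd : ∀ (n : ℕ) (j : ℤ), (|(j : ℝ)| + 1) * (a / 2 ^ (n + 3)) ∈ S →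
      D n j = 2 * g (j * (a / 2 ^ (n + 3))) - g ((j + 1) * (a / 2 ^ (n + 3))) -
        g ((j - 1) * (a / 2 ^ (n + 3)))) :
    ∃ (α β : ℝ) (σ : Measure ℝ), IsKreinHelicalMeasure σ ∧
      ∀ t ∈ S, g t = kreinHelicalRep α β σ t := by
  obtain ⟨A, ρ, hρ, hAre, hrep⟩ := exists_limit_rep ha hIcc hstar hg hherm hD hDd
  -- the measure `σ = π (1 + x²) ρ`
  set σ : Measure ℝ := ρ.withDensity (fun x => ENNReal.ofReal (Real.pi * (1 + x ^ 2))) with hσ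
  have hσK : IsKreinHelicalMeasure σ := by
    unfold IsKreinHelicalMeasure
    rw [hσ, lintegral_withDensity_eq_lintegral_mul _ (Measurable.ennreal_ofReal (by fun_prop))
      (Measurable.ennreal_ofReal (by fun_prop))]
    have : ((fun x : ℝ => ENNReal.ofReal (Real.pi * (1 + x ^ 2))) * fun x : ℝ =>
        ENNReal.ofReal ((1 + x ^ 2)⁻¹)) = fun _ => ENNReal.ofReal Real.pi := by
      funext x
      simp only [Pi.mul_apply]
      rw [← ENNReal.ofReal_mul (by positivity)]
      congr 1
      field_simp
    calc ∫⁻ x, ((fun x : ℝ => ENNReal.ofReal (Real.pi * (1 + x ^ 2))) *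
          fun x : ℝ => ENNReal.ofReal ((1 + x ^ 2)⁻¹)) x ∂ρ = ∫⁻ _x, ENNReal.ofReal Real.pi ∂ρ := by
          rw [this]
      _ < ⊤ := by
          rw [lintegral_const]
          exact ENNReal.mul_lt_top ENNReal.ofReal_lt_top (measure_lt_top _ _)
  have hσint : ∀ t : ℝ, (1 / Real.pi : ℂ) * ∫ x, kreinHelicalIntegrand t x ∂σ = ∫ x, (kreinHelicalIntegrand (t) (x) * (((1 : ℝ) + (x) ^ 2 : ℝ) : ℂ)) ∂ρ := by
    intro t
    rw [hσ, integral_withDensity_eq_integral_toReal_smul (Measurable.ennreal_ofReal (by fun_prop))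
      (ae_of_all _ fun x => ENNReal.ofReal_lt_top)]
    have : (fun x : ℝ => (ENNReal.ofReal (Real.pi * (1 + x ^ 2))).toReal • kreinHelicalIntegrand t x) =
        fun x : ℝ => (Real.pi : ℂ) * (kreinHelicalIntegrand (t) (x) * (((1 : ℝ) + (x) ^ 2 : ℝ) : ℂ)) := by
      funext x
      rw [ENNReal.toReal_ofReal (by positivity), Complex.real_smul]
      push_cast
      ring
    have hπ : (Real.pi : ℂ) ≠ 0 := by exact_mod_cast Real.pi_ne_zero
    rw [this, integral_const_mul, ← mul_assoc, show (1 / (Real.pi : ℂ)) * (Real.pi : ℂ) = 1 by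
      field_simp, one_mul]
  -- `α`, `β`
  have h0S : (0 : ℝ) ∈ S := hIcc ⟨by linarith, ha.le⟩
  have hg0 : (g 0).im = 0 := by
    have h := hherm 0 h0S
    rw [neg_zero] at h
    have := congrArg Complex.im h
    rw [Complex.conj_im] at this
    linarith
  have hAI : A = (A.im : ℂ) * I := by
    apply Complex.ext <;> simp [hAre]
  refine ⟨A.im, -(g 0).re, σ, hσK, ?_⟩
  -- equality at dyadic points
  have hT : ∀ t ∈ {t ∈ S | ∃ m : ℕ, ∃ j : ℤ, t = j * (a / 2 ^ m)},
      g t = kreinHelicalRep A.im (-(g 0).re) σ t := by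
    rintro t ⟨htS, m, j, rfl⟩
    rw [hrep m j htS, kreinHelicalRep, hσint]
    have hg0' : g 0 = (((g 0).re : ℝ) : ℂ) := Complex.ext (by simp) (by simp [hg0])
    conv_lhs => rw [hg0', hAI]
    push_cast
    ring
  -- extension by continuity
  refine eqOn_of_eqOn_dense (fun t ht => ht.1) hdense hg
    (hσK.continuous_kreinHelicalRep _ _).continuousOn hT

end Assembly

end Literature.Analysis.InverseSpectral
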